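import Literature.Analysis.FluidPDE.KatoPicardLp
import Literature.Analysis.FluidPDE.KochTataruPairing
import HarnessLib

/-!
# The Oseen–Duhamel term for fields with `L^p` slices, `3 < p < ∞`: `L^p` theory, tested form

Analysis/FluidPDE proofs file (theorems only: no definitions, no named facts) on the discharge
path of `Literature.Analysis.FluidPDE.chae2007_asymptoticallySelfSimilar_local` (D. Chae, Math. Ann.
338 (2007), Thm 1.5; the profile conclusion `V̄ = 0` for `3 < p < ∞`, which needs Kato's `L^p`
theory for a blow-up limit lying only in `L^∞_t L^p_x`). The tree's theory of Koch–Tataru's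
bilinear Duhamel operator
`B(u, v)(t)(x) = ∫_{(0,t)} ∫ K(t−τ, x−y)[u(τ,y), v(τ,y)] dy dτ` (`kochTataruBilinear`, unit
viscosity, `K = oseenKernel`) is a theory of fields which are pointwise bounded
(`KochTataruPairing.lean`: the path space `X`, `sup √t |u| < ∞`; `NSBoundedMildOseen*.lean`:
bounded fields), for which the double integral converges absolutely at **every** point. For fields
with slices merely in `L^p(ℝ³)`, `3 < p < ∞`, with Kato's weights
`‖u(τ)‖_{L^p} ≤ K_u τ^{-(1−3/p)/2}`, the double integral converges absolutely only at **almost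
every** point (the `L^∞_x` size of a slice is `∝ (t−τ)^{-1/2-3/p}`, integrable in `τ` only for
`p > 6`), and this file redoes the basic theory at that level (Kato 1984, §2; Fabes–Jones–Rivière
1972, §2; Lemarié-Rieusset 2016, Thm. 6.1):

* `LpOseen.lintegral_enorm_oseenSlice_le` — absolute convergence of every slice at every point,
  `∫ ‖K(σ, x−y)[a(y), b(y)]‖ dy ≤ C σ^{-1/2-3/p} ‖a‖_p ‖b‖_p`;
* `LpOseen.lintegral_slices_pairing_le` — the Tonelli majorant
  `∫∫_{(0,t)×ℝ³} ‖T_{t−τ}[u(τ), v(τ)](x)‖ |ψ(x)| ≤ c K_u K_v ‖ψ‖_{p'} < ∞` for `ψ ∈ L^{p'}`, whence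
  `LpOseen.ae_integrableOn_slices`: for a.e. `x` the time integral defining `B(u,v)(t)(x)`
  converges absolutely;
* `LpOseen.memLp_kochTataruBilinear` — `B(u,v)(t) ∈ L^p` with Kato's bound (the tree's
  `KatoLp.exists_eLpNorm_oseenDuhamel_le_Lp`);
* `LpOseen.integral_inner_oseenSlice` — the slice against a test field,
  `∫⟪T_σ[a,b], φ⟫ = −∫⟪b, D(e^{σΔ}φ) a⟫` for solenoidal `φ`, `= 0` against gradients (Fubini over
  `ℝ³ × ℝ³` under `∫ |a||b| (Env_σ ⋆ |φ|) < ∞`, and the kernel identities of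
  `KochTataruPairing.lean`);
* `LpOseen.integral_inner_kochTataruBilinear_eq_neg_intervalIntegral` — **the tested form**
  `∫⟪B(u,u)(t), φ⟫ = −∫₀ᵗ∫⟪u, (u·∇)e^{(t−τ)Δ}φ⟫ dτ` for solenoidal `φ`;
* `LpOseen.isWeaklyDivFree_kochTataruBilinear` — `B(u,v)(t)` is weakly divergence free.

## References

* T. Kato, Math. Z. 187 (1984) 471–480, §2, (2.3)–(2.4'). [Kato1984]
* E. B. Fabes, B. F. Jones, N. M. Rivière, Arch. Rational Mech. Anal. 45 (1972), §2, Thm. 2.1.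
  [FabesJonesRiviere1972]
* P. G. Lemarié-Rieusset, *The Navier–Stokes Problem in the 21st Century* (2016), Thm. 6.1,
  (6.11)–(6.12), Thm. 7.5 (proof). [LemarieRieusset2016]
* H. Koch, D. Tataru, Adv. Math. 157 (2001), §2 (8), §3 (11), (14). [KochTataruAdvMath2001]
-/

noncomputable section

open MeasureTheory TopologicalSpace Set Function Filter Topology InnerProductSpace Metric
open scoped RealInnerProductSpace ENNReal NNReal

namespace Literature.Analysis.FluidPDE

namespace LpOseen

/-- Local notation for physical space `ℝ³ = EuclideanSpace ℝ (Fin 3)`. -/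
local notation "ℝ³" => EuclideanSpace ℝ (Fin 3)

/-- `(finrank ℝ ℝ³ : ℝ) = 3`. [folklore] -/
theorem finrank_R3_real : (Module.finrank ℝ ℝ³ : ℝ) = 3 := by
  rw [finrank_euclideanSpace_fin]; norm_num

/-! ### Exponents -/

section Exponents

variable {p : ℝ≥0∞}

/-- `p/2 > 1` for `p > 3`. [folklore] -/
theorem one_lt_half (hp₃ : 3 < p) : 1 < p / 2 := by
  rw [ENNReal.lt_div_iff_mul_lt (Or.inl two_ne_zero) (Or.inl ENNReal.ofNat_ne_top), one_mul]
  exact lt_trans (by norm_num) hp₃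

/-- `p/2 ≠ ∞` for `p < ∞`. [folklore] -/
theorem half_ne_top (hp : p < ∞) : p / 2 ≠ ∞ := ENNReal.div_ne_top hp.ne two_ne_zero

/-- The conjugate exponent of `p/2` as an element of `ℝ≥0∞`: `r = (1 − 2/p)⁻¹`, with
`(p/2)⁻¹ + r⁻¹ = 1`. We use Mathlib's construction `HolderTriple.of`-free form: `r := (1 - (p/2)⁻¹)⁻¹`.
[folklore] -/
theorem holderConjugate_half (hp₃ : 3 < p) :
    (p / 2).HolderConjugate (1 - (p / 2)⁻¹)⁻¹ := by
  rw [ENNReal.holderConjugate_iff, inv_inv]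
  exact add_tsub_cancel_of_le (ENNReal.inv_le_one.2 (one_lt_half hp₃).le)

/-- The conjugate exponent of `p` in `ℝ≥0∞`: `p' = (1 − p⁻¹)⁻¹`. [folklore] -/
theorem holderConjugate_self (hp1 : 1 < p) : p.HolderConjugate (1 - p⁻¹)⁻¹ := by
  rw [ENNReal.holderConjugate_iff, inv_inv]
  exact add_tsub_cancel_of_le (ENNReal.inv_le_one.2 hp1.le)

/-- The conjugate exponent `(1 − q⁻¹)⁻¹` of `1 < q` is `≥ 1`. [folklore] -/
theorem one_le_conj (q : ℝ≥0∞) : (1 : ℝ≥0∞) ≤ (1 - q⁻¹)⁻¹ := by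
  rw [ENNReal.one_le_inv]
  exact tsub_le_self

/-- The conjugate exponent `(1 − q⁻¹)⁻¹` of `1 < q` is finite. [folklore] -/
theorem conj_ne_top {q : ℝ≥0∞} (hq : 1 < q) : (1 - q⁻¹)⁻¹ ≠ ∞ := by
  rw [Ne, ENNReal.inv_eq_top, tsub_eq_zero_iff_le, not_le]
  exact ENNReal.inv_lt_one.2 hq

/-- `toReal` of the conjugate exponent of `p/2`: `((1 − 2/p)⁻¹).toReal = p/(p−2)` in the form
`1/r = 1 − 2/p`. [folklore] -/
theorem one_div_toReal_conj_half (hp₃ : 3 < p) :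
    1 / ((1 - (p / 2)⁻¹)⁻¹).toReal = 1 - 2 / p.toReal := by
  have hp0 : p ≠ 0 := (lt_trans (by norm_num) hp₃).ne'
  have h2p : (p / 2)⁻¹ ≤ 1 := ENNReal.inv_le_one.2 (one_lt_half hp₃).le
  rw [one_div, ENNReal.toReal_inv, inv_inv, ENNReal.toReal_sub_of_le h2p ENNReal.one_ne_top,
    ENNReal.toReal_one, ENNReal.toReal_inv, ENNReal.toReal_div, ENNReal.toReal_ofNat]
  rw [inv_div]

/-- `toReal` of the conjugate exponent of `p`: `1/p' = 1 − 1/p`. [folklore] -/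
theorem one_div_toReal_conj_self (hp1 : 1 < p) :
    1 / ((1 - p⁻¹)⁻¹).toReal = 1 - 1 / p.toReal := by
  have hpi : p⁻¹ ≤ 1 := ENNReal.inv_le_one.2 hp1.le
  rw [one_div, ENNReal.toReal_inv, inv_inv, ENNReal.toReal_sub_of_le hpi ENNReal.one_ne_top,
    ENNReal.toReal_one, ENNReal.toReal_inv, one_div]

end Exponents

/-! ### The envelope and the slices at every point -/

section Slice

variable {p : ℝ≥0∞}

/-- **Absolute convergence of every slice at every point, with its size**: for `3 < p < ∞`
there is `C ≥ 0` such that for `σ > 0` and a.e.-strongly measurable `a, b`,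
`∫ ‖K(σ, x−y)[a(y), b(y)]‖ dy ≤ C σ^{-1/2-3/p} ‖a‖_{L^p} ‖b‖_{L^p}` for **every** `x` (the
envelope `C(σ + |z|²)^{-2}` in `L^{(p/2)'}`, `|a||b|` in `L^{p/2}`, Hölder; Kato 1984, (2.4')).
[cite: Kato1984, (2.4')] -/
theorem exists_lintegral_enorm_oseenSlice_le (hp₃ : 3 < p) :
    ∃ C : ℝ, 0 ≤ C ∧ ∀ {σ : ℝ}, 0 < σ → ∀ {a b : ℝ³ → ℝ³}, AEStronglyMeasurable a volume →
      AEStronglyMeasurable b volume → ∀ x : ℝ³,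
        ∫⁻ y, ‖oseenKernel σ (x - y) (a y) (b y)‖ₑ ≤
          ENNReal.ofReal (C * σ ^ (-(1 / 2 + 3 / p.toReal))) *
            (eLpNorm a p volume * eLpNorm b p volume) := by
  haveI := KatoLp.holderTriple_self_self_half p
  haveI hconj := holderConjugate_half hp₃
  set r : ℝ≥0∞ := (1 - (p / 2)⁻¹)⁻¹ with hr
  have hr1 : 1 ≤ r := one_le_conj _
  have hrtop : r ≠ ∞ := conj_ne_top (one_lt_half hp₃)
  obtain ⟨C, hC, hK⟩ := exists_norm_oseenKernel_le (E := ℝ³)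
  obtain ⟨Cr, hCr, hEnv⟩ := exists_eLpNorm_oseenEnvelope_le (E := ℝ³) hC.le hr1 hrtop
  have hexp : (Module.finrank ℝ ℝ³ : ℝ) / (2 * r.toReal) - ((Module.finrank ℝ ℝ³ : ℝ) + 1) / 2 =
      -(1 / 2 + 3 / p.toReal) := by
    rw [finrank_R3_real]
    have h1 : (3 : ℝ) / (2 * r.toReal) = 3 / 2 * (1 / r.toReal) := by ring
    rw [h1, one_div_toReal_conj_half hp₃]
    ring
  refine ⟨Cr, hCr, fun {σ} hσ {a b} ha hb x => ?_⟩
  set d : ℝ := (Module.finrank ℝ ℝ³ : ℝ) with hd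
  set Env : ℝ³ → ℝ := fun z => C * (σ + ‖z‖ ^ 2) ^ (-((d + 1) / 2)) with hEnvdef
  set g : ℝ³ → ℝ := fun y => ‖a y‖ * ‖b y‖ with hg
  have hEnv0 : ∀ z, 0 ≤ Env z := fun z => mul_nonneg hC.le (Real.rpow_nonneg (by positivity) _)
  have hEnvm : AEStronglyMeasurable Env volume :=
    (measurable_const.mul ((measurable_const.add (measurable_norm.pow_const 2)).pow
      measurable_const)).aestronglyMeasurable
  have hgm : AEStronglyMeasurable g volume := ha.norm.mul hb.norm
  -- pointwise domination
  have hpt : ∀ y, ‖oseenKernel σ (x - y) (a y) (b y)‖ₑ ≤ ‖Env (x - y)‖ₑ * ‖g y‖ₑ := by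
    intro y
    have h := hK hσ (x - y) (a y) (b y)
    rw [← ofReal_norm, Real.enorm_eq_ofReal (hEnv0 _),
      Real.enorm_eq_ofReal (mul_nonneg (norm_nonneg _) (norm_nonneg _)),
      ← ENNReal.ofReal_mul (hEnv0 _)]
    refine ENNReal.ofReal_le_ofReal ?_
    calc ‖oseenKernel σ (x - y) (a y) (b y)‖
        ≤ C * (σ + ‖x - y‖ ^ 2) ^ (-((d + 1) / 2)) * ‖a y‖ * ‖b y‖ := h
      _ = Env (x - y) * g y := by rw [hEnvdef, hg]; ring
  -- Hölder
  have hmp : MeasurePreserving (fun y : ℝ³ => x - y) volume volume :=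
    Measure.measurePreserving_sub_left volume x
  have hEnvx : AEStronglyMeasurable (fun y => Env (x - y)) volume := hEnvm.comp_measurePreserving hmp
  calc ∫⁻ y, ‖oseenKernel σ (x - y) (a y) (b y)‖ₑ
      ≤ ∫⁻ y, ‖Env (x - y)‖ₑ * ‖g y‖ₑ := lintegral_mono hpt
    _ = eLpNorm ((fun y => Env (x - y)) • g) 1 volume := by
        rw [eLpNorm_one_eq_lintegral_enorm]
        simp_rw [Pi.smul_apply', enorm_smul]
    _ ≤ eLpNorm (fun y => Env (x - y)) r volume * eLpNorm g (p / 2) volume :=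
        eLpNorm_smul_le_mul_eLpNorm hgm hEnvx
    _ = eLpNorm Env r volume * eLpNorm g (p / 2) volume := by
        rw [show (fun y => Env (x - y)) = Env ∘ (fun y => x - y) from rfl,
          eLpNorm_comp_measurePreserving hEnvm hmp]
    _ ≤ ENNReal.ofReal (Cr * σ ^ (-(1 / 2 + 3 / p.toReal))) *
          (eLpNorm a p volume * eLpNorm b p volume) := by
        refine mul_le_mul' ?_ (eLpNorm_norm_mul_norm_le ha hb p p (p / 2))
        have h := hEnv σ hσ
        rw [hexp] at h
        exact h

/-- **Every slice is an absolutely convergent integral at every point** (`3 < p < ∞`, `σ > 0`,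
`a, b ∈ L^p`). [cite: Kato1984, (2.4')] -/
theorem integrable_oseenSlice (hp₃ : 3 < p) {σ : ℝ} (hσ : 0 < σ) {a b : ℝ³ → ℝ³}
    (ha : MemLp a p volume) (hb : MemLp b p volume) (x : ℝ³) :
    Integrable (fun y => oseenKernel σ (x - y) (a y) (b y)) volume := by
  obtain ⟨C, hC, h⟩ := exists_lintegral_enorm_oseenSlice_le (p := p) hp₃
  have hm : AEStronglyMeasurable (fun y => oseenKernel σ (x - y) (a y) (b y)) volume := by
    have h1 : AEMeasurable (fun y : ℝ³ => oseenKernel σ (x - y) (a y) (b y)) volume :=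
      AEMeasurable.oseenKernel_comp aemeasurable_const (measurable_const.sub measurable_id).aemeasurable
        ha.1.aemeasurable hb.1.aemeasurable
    exact h1.aestronglyMeasurable
  refine ⟨hm, ?_⟩
  rw [hasFiniteIntegral_iff_enorm]
  refine lt_of_le_of_lt (h hσ ha.1 hb.1 x) ?_
  exact ENNReal.mul_lt_top ENNReal.ofReal_lt_top (ENNReal.mul_lt_top ha.2 hb.2)

end Slice

/-! ### The Tonelli majorant and the a.e. absolute convergence of the time integral -/

section Duhamel

variable {p : ℝ≥0∞} {u v : ℝ → ℝ³ → ℝ³} {t Ku Kv : ℝ}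

/-- **`L^{p'}` pairing of the `L^p` size of the slices** (Hölder in `x`): for `ψ ∈ L^{p'}`,
`∫ ‖S(x)‖ |ψ(x)| dx ≤ ‖S‖_{L^p} ‖ψ‖_{L^{p'}}` in `ℝ≥0∞`, `p' = (1 − p⁻¹)⁻¹`. [folklore] -/
theorem lintegral_enorm_mul_enorm_le (hp1 : 1 < p) {S : ℝ³ → ℝ³} {ψ : ℝ³ → ℝ}
    (hS : AEStronglyMeasurable S volume) (hψ : AEStronglyMeasurable ψ volume) :
    ∫⁻ x, ‖S x‖ₑ * ‖ψ x‖ₑ ≤ eLpNorm S p volume * eLpNorm ψ (1 - p⁻¹)⁻¹ volume := by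
  haveI := holderConjugate_self hp1
  calc ∫⁻ x, ‖S x‖ₑ * ‖ψ x‖ₑ = ∫⁻ x, ‖ψ x‖ₑ * ‖S x‖ₑ := lintegral_congr fun x => mul_comm _ _
    _ = eLpNorm (ψ • S) 1 volume := by
        rw [eLpNorm_one_eq_lintegral_enorm]
        simp_rw [Pi.smul_apply', enorm_smul]
    _ ≤ eLpNorm ψ (1 - p⁻¹)⁻¹ volume * eLpNorm S p volume := eLpNorm_smul_le_mul_eLpNorm hS hψ
    _ = eLpNorm S p volume * eLpNorm ψ (1 - p⁻¹)⁻¹ volume := mul_comm _ _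

/-- **The Tonelli majorant** (Kato 1984, (2.3)–(2.4); Fabes–Jones–Rivière 1972, §2): for
`3 < p < ∞` there is `c ≥ 0` such that for jointly measurable `u, v` with
`‖u(τ)‖_{L^p} ≤ K_u τ^{-(1-3/p)/2}`, `‖v(τ)‖_{L^p} ≤ K_v τ^{-(1-3/p)/2}` on `(0, t)` and
`ψ ∈ L^{p'}`,
`∫_{(0,t)} ∫ ‖T_{t−τ}[u(τ), v(τ)](x)‖ |ψ(x)| dx dτ ≤ c K_u K_v t^{-(1-3/p)/2} ‖ψ‖_{L^{p'}}`
(the slice bound `‖T_σ[a,b]‖_p ≤ C σ^{-1/2-3/(2p)}‖a‖_p‖b‖_p`, Hölder in `x`, and the Beta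
integral in `τ`). [cite: Kato1984, (2.3)–(2.4)] -/
theorem exists_lintegral_slices_pairing_le (hp₃ : 3 < p) (hp : p < ∞) :
    ∃ c : ℝ, 0 ≤ c ∧ ∀ {u v : ℝ → ℝ³ → ℝ³}, Measurable (uncurry u) → Measurable (uncurry v) →
      ∀ {Ku Kv : ℝ}, 0 ≤ Ku → 0 ≤ Kv → ∀ {t : ℝ}, 0 < t →
        (∀ τ ∈ Ioo 0 t, eLpNorm (u τ) p volume ≤
          ENNReal.ofReal (Ku * τ ^ (-((1 - 3 / p.toReal) / 2)))) →
        (∀ τ ∈ Ioo 0 t, eLpNorm (v τ) p volume ≤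
          ENNReal.ofReal (Kv * τ ^ (-((1 - 3 / p.toReal) / 2)))) →
        ∀ {ψ : ℝ³ → ℝ}, AEStronglyMeasurable ψ volume →
          ∫⁻ τ in Ioo 0 t, ∫⁻ x, ‖∫ y, oseenKernel (t - τ) (x - y) (u τ y) (v τ y)‖ₑ * ‖ψ x‖ₑ ≤
            ENNReal.ofReal (c * Ku * Kv * t ^ (-((1 - 3 / p.toReal) / 2))) *
              eLpNorm ψ (1 - p⁻¹)⁻¹ volume := by
  obtain ⟨C, hC, hS⟩ :=
    KatoLp.exists_eLpNorm_oseenSlice_le_Lp (E := ℝ³) finrank_euclideanSpace_fin hp₃ hp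
  have hr3 := KatoLp.three_lt_toReal hp₃ hp
  have hp1 : 1 < p := lt_trans (by norm_num) hp₃
  set r : ℝ := p.toReal with hr
  set ae : ℝ := 1 / 2 + 3 / (2 * r) with hae
  set s : ℝ := 1 - 3 / r with hs
  have hr0 : 0 < r := by linarith
  have h3r : 3 / r < 1 := by rw [div_lt_one hr0]; exact hr3
  have h3r0 : 0 < 3 / r := by positivity
  have h3r2 : 3 / (2 * r) < 1 / 2 := by
    rw [div_lt_div_iff₀ (by positivity) (by norm_num)]; linarith
  have hae0 : 0 ≤ ae := by positivity
  have hae1 : ae < 1 := by rw [hae]; linarith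
  have hs0 : 0 ≤ s := by rw [hs]; linarith
  have hs1 : s < 1 := by rw [hs]; linarith
  have hexp : 1 - ae - s = -(s / 2) := by
    rw [hae, hs]; field_simp; ring
  set I : ℝ := ∫ x in (0 : ℝ)..1, (1 - x) ^ (-ae) * x ^ (-s) with hI
  have hI0 : 0 ≤ I := integral_one_sub_rpow_mul_rpow_nonneg _ _
  refine ⟨C * I, by positivity, fun {u v} hum hvm {Ku Kv} hKu hKv {t} ht hu hv {ψ} hψ => ?_⟩
  set Sl : ℝ → ℝ³ → ℝ³ := fun τ x => ∫ y, oseenKernel (t - τ) (x - y) (u τ y) (v τ y) with hSl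
  have hSm : StronglyMeasurable (uncurry Sl) := by
    have h := stronglyMeasurable_oseenIntegrand hum hvm 1 t
    simp only [one_mul] at h
    exact h
  have hslice : ∀ τ ∈ Ioo 0 t, ∫⁻ x, ‖Sl τ x‖ₑ * ‖ψ x‖ₑ ≤
      ENNReal.ofReal (C * Ku * Kv * ((t - τ) ^ (-ae) * τ ^ (-s))) * eLpNorm ψ (1 - p⁻¹)⁻¹ volume := by
    intro τ hτ
    have hστ : 0 < t - τ := sub_pos.2 hτ.2
    have hτ0 : 0 < τ := hτ.1
    have hSτ : AEStronglyMeasurable (Sl τ) volume :=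
      (hSm.comp_measurable (measurable_const.prodMk measurable_id)).aestronglyMeasurable
    refine (lintegral_enorm_mul_enorm_le hp1 hSτ hψ).trans (mul_le_mul' ?_ le_rfl)
    have h1 := hS hστ (measurable_slice hum τ).aestronglyMeasurable
      (measurable_slice hvm τ).aestronglyMeasurable
    refine h1.trans ?_
    calc ENNReal.ofReal (C * (t - τ) ^ (-ae)) * (eLpNorm (u τ) p volume * eLpNorm (v τ) p volume)
        ≤ ENNReal.ofReal (C * (t - τ) ^ (-ae)) *
            (ENNReal.ofReal (Ku * τ ^ (-(s / 2))) * ENNReal.ofReal (Kv * τ ^ (-(s / 2)))) := by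
          gcongr
          · exact hu τ hτ
          · exact hv τ hτ
      _ = ENNReal.ofReal (C * Ku * Kv * ((t - τ) ^ (-ae) * τ ^ (-s))) := by
          rw [← ENNReal.ofReal_mul (by positivity),
            ← ENNReal.ofReal_mul (mul_nonneg hC (Real.rpow_nonneg hστ.le _))]
          congr 1
          rw [← KatoLp.rpow_neg_half_mul_self hτ0 s]
          ring
  calc ∫⁻ τ in Ioo 0 t, ∫⁻ x, ‖Sl τ x‖ₑ * ‖ψ x‖ₑ
      ≤ ∫⁻ τ in Ioo 0 t, ENNReal.ofReal (C * Ku * Kv * ((t - τ) ^ (-ae) * τ ^ (-s))) *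
          eLpNorm ψ (1 - p⁻¹)⁻¹ volume :=
        setLIntegral_mono' measurableSet_Ioo fun τ hτ => hslice τ hτ
    _ = (∫⁻ τ in Ioo 0 t, ENNReal.ofReal (C * Ku * Kv * ((t - τ) ^ (-ae) * τ ^ (-s)))) *
          eLpNorm ψ (1 - p⁻¹)⁻¹ volume := by
        rw [lintegral_mul_const]
        exact (ENNReal.measurable_ofReal.comp (measurable_const.mul
          (((measurable_const.sub measurable_id).pow_const _).mul (measurable_id.pow_const _))))
    _ = ENNReal.ofReal (C * Ku * Kv * (t ^ (1 - ae - s) * I)) * eLpNorm ψ (1 - p⁻¹)⁻¹ volume := by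
        rw [lintegral_Ioo_ofReal_sub_rpow_mul_rpow hae0 hae1 hs0 hs1 (by positivity) ht]
    _ = ENNReal.ofReal (C * I * Ku * Kv * t ^ (-(s / 2))) * eLpNorm ψ (1 - p⁻¹)⁻¹ volume := by
        rw [hexp]
        congr 2
        ring

/-- **A positive `L^{q}` weight on `ℝ³`**: the unit Gaussian `G₁` is positive, measurable and in
every `L^q`, `1 ≤ q`. [folklore] -/
theorem gaussian_weight (q : ℝ≥0∞) (hq : 1 ≤ q) :
    (∀ x : ℝ³, 0 < UnboundedOperators.heatKernel (E := ℝ³) 1 x) ∧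
      MemLp (UnboundedOperators.heatKernel (E := ℝ³) 1) q volume :=
  ⟨fun x => UnboundedOperators.heatKernel_pos one_pos x, UnboundedOperators.memLp_heatKernel one_pos hq⟩

/-- **For a.e. `x` the time integral converges absolutely** (under the hypotheses of
`exists_lintegral_slices_pairing_le`): `∫_{(0,t)} ‖T_{t−τ}[u(τ), v(τ)](x)‖ dτ < ∞` for almost
every `x`, hence `τ ↦ T_{t−τ}[u(τ), v(τ)](x)` is Bochner integrable on `(0, t)` for a.e. `x` (pair
the majorant with the positive Gaussian weight `G₁ ∈ L^{p'}`). [cite: Kato1984, (2.3)–(2.4)] -/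
theorem ae_integrableOn_slices (hp₃ : 3 < p) (hp : p < ∞) (hum : Measurable (uncurry u))
    (hvm : Measurable (uncurry v)) (hKu : 0 ≤ Ku) (hKv : 0 ≤ Kv) (ht : 0 < t)
    (hu : ∀ τ ∈ Ioo 0 t, eLpNorm (u τ) p volume ≤
      ENNReal.ofReal (Ku * τ ^ (-((1 - 3 / p.toReal) / 2))))
    (hv : ∀ τ ∈ Ioo 0 t, eLpNorm (v τ) p volume ≤
      ENNReal.ofReal (Kv * τ ^ (-((1 - 3 / p.toReal) / 2)))) :
    ∀ᵐ x : ℝ³ ∂volume, IntegrableOn (fun τ => ∫ y, oseenKernel (t - τ) (x - y) (u τ y) (v τ y))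
      (Ioo 0 t) volume := by
  obtain ⟨c, hc, hmaj⟩ := exists_lintegral_slices_pairing_le (p := p) hp₃ hp
  have hp1 : 1 < p := lt_trans (by norm_num) hp₃
  set G : ℝ³ → ℝ := UnboundedOperators.heatKernel (E := ℝ³) 1 with hG
  obtain ⟨hGpos, hGmem⟩ := gaussian_weight (1 - p⁻¹)⁻¹ (one_le_conj p)
  set Sl : ℝ → ℝ³ → ℝ³ := fun τ x => ∫ y, oseenKernel (t - τ) (x - y) (u τ y) (v τ y) with hSl
  have hSm : StronglyMeasurable (uncurry Sl) := by
    have h := stronglyMeasurable_oseenIntegrand hum hvm 1 t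
    simp only [one_mul] at h
    exact h
  -- measurability of the weighted slices on `ℝ³ × ℝ`
  have hGc : Continuous G := UnboundedOperators.continuous_heatKernel (E := ℝ³) 1
  have h1 : Measurable fun q : ℝ³ × ℝ => Sl q.2 q.1 := by
    have e : (fun q : ℝ³ × ℝ => Sl q.2 q.1) = uncurry Sl ∘ Prod.swap := by
      funext q; rfl
    rw [e]
    exact hSm.measurable.comp measurable_swap
  have hF0 : Measurable (uncurry fun (x : ℝ³) (τ : ℝ) => ‖Sl τ x‖ₑ) := h1.enorm
  have hF : Measurable (uncurry fun (x : ℝ³) (τ : ℝ) => ‖Sl τ x‖ₑ * ‖G x‖ₑ) :=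
    hF0.mul (hGc.measurable.comp measurable_fst).enorm
  -- the weighted double integral is finite
  have hfin : ∫⁻ x, (∫⁻ τ in Ioo 0 t, ‖Sl τ x‖ₑ) * ‖G x‖ₑ < ⊤ := by
    have e1 : ∫⁻ x, (∫⁻ τ in Ioo 0 t, ‖Sl τ x‖ₑ) * ‖G x‖ₑ =
        ∫⁻ x, ∫⁻ τ in Ioo 0 t, ‖Sl τ x‖ₑ * ‖G x‖ₑ := by
      refine lintegral_congr fun x => ?_
      rw [lintegral_mul_const]
      have e : (fun τ => Sl τ x) = uncurry Sl ∘ fun τ => (τ, x) := by funext τ; rfl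
      have hmx : Measurable fun τ => Sl τ x := by
        rw [e]; exact hSm.measurable.comp (measurable_id.prodMk measurable_const)
      exact hmx.enorm
    rw [e1, lintegral_lintegral_swap (hF.aemeasurable)]
    refine lt_of_le_of_lt (hmaj hum hvm hKu hKv ht hu hv hGmem.1) ?_
    exact ENNReal.mul_lt_top ENNReal.ofReal_lt_top hGmem.2
  -- hence finite at a.e. `x`
  have hmeasI : AEMeasurable (fun x => (∫⁻ τ in Ioo 0 t, ‖Sl τ x‖ₑ) * ‖G x‖ₑ) volume :=
    ((hF0.lintegral_prod_right' (ν := volume.restrict (Ioo 0 t))).mul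
      (hGc.measurable.enorm)).aemeasurable
  have hae := ae_lt_top' hmeasI hfin.ne
  filter_upwards [hae] with x hx
  have hGx : ‖G x‖ₑ ≠ 0 := by
    rw [Real.enorm_eq_ofReal (hGpos x).le]
    exact (ENNReal.ofReal_pos.2 (hGpos x)).ne'
  have hIx : ∫⁻ τ in Ioo 0 t, ‖Sl τ x‖ₑ < ⊤ := by
    rcases ENNReal.mul_lt_top_iff.1 hx with h | h | h
    · exact h.1
    · rw [h]; exact ENNReal.zero_lt_top
    · exact absurd h hGx
  refine ⟨(hSm.comp_measurable (measurable_id.prodMk measurable_const)).aestronglyMeasurable, ?_⟩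
  rw [hasFiniteIntegral_iff_enorm]
  exact hIx

/-- **`B(u, v)(t) ∈ L^p` with Kato's bound** (the tree's `KatoLp.exists_eLpNorm_oseenDuhamel_le_Lp`
plus measurability): `‖B(u,v)(t)‖_{L^p} ≤ c K_u K_v t^{-(1-3/p)/2}`. [cite: Kato1984, (2.3)–(2.4)] -/
theorem exists_memLp_kochTataruBilinear (hp₃ : 3 < p) (hp : p < ∞) :
    ∃ c : ℝ, 0 ≤ c ∧ ∀ {u v : ℝ → ℝ³ → ℝ³}, Measurable (uncurry u) → Measurable (uncurry v) →
      ∀ {Ku Kv : ℝ}, 0 ≤ Ku → 0 ≤ Kv → ∀ {t : ℝ}, 0 < t →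
        (∀ τ ∈ Ioo 0 t, eLpNorm (u τ) p volume ≤
          ENNReal.ofReal (Ku * τ ^ (-((1 - 3 / p.toReal) / 2)))) →
        (∀ τ ∈ Ioo 0 t, eLpNorm (v τ) p volume ≤
          ENNReal.ofReal (Kv * τ ^ (-((1 - 3 / p.toReal) / 2)))) →
        MemLp (kochTataruBilinear u v t) p volume ∧
          eLpNorm (kochTataruBilinear u v t) p volume ≤
            ENNReal.ofReal (c * Ku * Kv * t ^ (-((1 - 3 / p.toReal) / 2))) := by
  obtain ⟨c, hc, hB⟩ :=
    KatoLp.exists_eLpNorm_oseenDuhamel_le_Lp (E := ℝ³) finrank_euclideanSpace_fin hp₃ hp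
  refine ⟨c, hc, fun {u v} hum hvm {Ku Kv} hKu hKv {t} ht hu hv => ?_⟩
  have hmeas : AEStronglyMeasurable (kochTataruBilinear u v t) volume := by
    have h := KatoLp.measurable_uncurry_oseenDuhamel_one hum hvm
    exact (h.comp (measurable_const.prodMk measurable_id)).aestronglyMeasurable
  have hle := hB hum hvm hKu hKv ht hu hv
  exact ⟨⟨hmeas, lt_of_le_of_lt hle ENNReal.ofReal_lt_top⟩, hle⟩

end Duhamel

/-! ### A slice against a test field: Fubini over `ℝ³ × ℝ³` -/

section SlicePairing

variable {p : ℝ≥0∞}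

/-- The envelope is even. [folklore] -/
theorem envelope_neg (C σ e : ℝ) (z : ℝ³) :
    C * (σ + ‖-z‖ ^ 2) ^ e = C * (σ + ‖z‖ ^ 2) ^ e := by rw [norm_neg]

/-- **Integrability over `ℝ³ × ℝ³` of a slice against a continuous compactly supported field**:
for `3 < p < ∞`, `σ > 0`, `a, b ∈ L^p`,
`∫∫ |⟪K(σ, x−y)[a(y), b(y)], φ(x)⟫| dx dy ≤ ∫ |a||b|(y) (Env_σ ⋆ |φ|)(y) dy < ∞`
(`|a||b| ∈ L^{p/2}`, and `Env_σ ⋆ |φ| ∈ L^{(p/2)'}` by Young with the `L¹` envelope). [folklore] -/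
theorem integrable_inner_oseenSlice_prod (hp₃ : 3 < p) {σ : ℝ} (hσ : 0 < σ)
    {a b : ℝ³ → ℝ³} (ha : MemLp a p volume) (hb : MemLp b p volume) {φ : ℝ³ → ℝ³}
    (hφc : Continuous φ) (hφs : HasCompactSupport φ) :
    Integrable (uncurry fun (x y : ℝ³) => ⟪oseenKernel σ (x - y) (a y) (b y), φ x⟫)
      ((volume : Measure ℝ³).prod (volume : Measure ℝ³)) := by
  haveI := KatoLp.holderTriple_self_self_half p
  haveI hconj := holderConjugate_half hp₃
  set r : ℝ≥0∞ := (1 - (p / 2)⁻¹)⁻¹ with hr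
  have hr1 : 1 ≤ r := one_le_conj _
  obtain ⟨C, hC, hK⟩ := exists_norm_oseenKernel_le (E := ℝ³)
  set d : ℝ := (Module.finrank ℝ ℝ³ : ℝ) with hd
  set Env : ℝ³ → ℝ := fun z => C * (σ + ‖z‖ ^ 2) ^ (-((d + 1) / 2)) with hEnvdef
  set g : ℝ³ → ℝ := fun y => ‖a y‖ * ‖b y‖ with hg
  have hEnv0 : ∀ z, 0 ≤ Env z := fun z => mul_nonneg hC.le (Real.rpow_nonneg (by positivity) _)
  have hEnvmeas : Measurable Env :=
    measurable_const.mul ((measurable_const.add (measurable_norm.pow_const 2)).pow measurable_const)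
  have hEnvm : AEStronglyMeasurable Env volume := hEnvmeas.aestronglyMeasurable
  have hEnvb : ∀ z, Env z ≤ C * σ ^ (-((d + 1) / 2)) := by
    intro z
    refine mul_le_mul_of_nonneg_left ?_ hC.le
    exact Real.rpow_le_rpow_of_nonpos hσ (le_add_of_nonneg_right (sq_nonneg _))
      (by rw [hd, finrank_R3_real]; norm_num)
  have hgm : AEStronglyMeasurable g volume := ha.1.norm.mul hb.1.norm
  have hgmem : eLpNorm g (p / 2) volume < ⊤ :=
    lt_of_le_of_lt (eLpNorm_norm_mul_norm_le ha.1 hb.1 p p (p / 2)) (ENNReal.mul_lt_top ha.2 hb.2)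
  -- the test field
  have hφi : Integrable φ volume := hφc.integrable_of_hasCompactSupport hφs
  have hφn : Integrable (fun x => ‖φ x‖) volume := hφi.norm
  have hφmem : ∀ q : ℝ≥0∞, MemLp (fun x => ‖φ x‖) q volume := fun q =>
    (hφc.norm).memLp_of_hasCompactSupport hφs.norm
  -- the convolution `T(y) = ∫ Env(x - y) |φ(x)| dx`
  set T : ℝ³ → ℝ := fun y => ∫ x, Env (x - y) * ‖φ x‖ with hT
  have hTint : ∀ y, Integrable (fun x => Env (x - y) * ‖φ x‖) volume := by
    intro y
    refine (hφn.const_mul (C * σ ^ (-((d + 1) / 2)))).mono' ?_ (Eventually.of_forall fun x => ?_)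
    · exact ((hEnvmeas.comp (measurable_id.sub measurable_const)).aestronglyMeasurable).mul hφn.1
    · rw [Real.norm_of_nonneg (mul_nonneg (hEnv0 _) (norm_nonneg _))]
      exact mul_le_mul_of_nonneg_right (hEnvb _) (norm_nonneg _)
  have hTeq : ∀ y, ‖T y‖ₑ = ∫⁻ x, ‖Env (x - y)‖ₑ * ‖φ x‖ₑ := by
    intro y
    have hnn : 0 ≤ T y := integral_nonneg fun x => mul_nonneg (hEnv0 _) (norm_nonneg _)
    rw [Real.enorm_eq_ofReal hnn, hT]
    dsimp only
    rw [ofReal_integral_eq_lintegral_ofReal (hTint y)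
      (Eventually.of_forall fun x => mul_nonneg (hEnv0 _) (norm_nonneg _))]
    refine lintegral_congr fun x => ?_
    rw [ENNReal.ofReal_mul (hEnv0 _), ← Real.enorm_eq_ofReal (hEnv0 _), ← ofReal_norm (φ x)]
  -- Young: `T ∈ L^r`
  have hTdom : ∀ y, ‖T y‖ₑ ≤ ∫⁻ w, ‖Env w‖ₑ * ‖(fun x => ‖φ x‖) (y - w)‖ₑ := by
    intro y
    rw [hTeq y]
    have h := lintegral_sub_left_eq_self (μ := (volume : Measure ℝ³))
      (fun x => ‖Env (x - y)‖ₑ * ‖φ x‖ₑ) y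
    rw [← h]
    refine le_of_eq (lintegral_congr fun w => ?_)
    simp only [enorm_norm]
    rw [show y - w - y = -w by abel, hEnvdef]
    dsimp only
    rw [envelope_neg]
  have hTm : AEStronglyMeasurable T volume := by
    have h : StronglyMeasurable (uncurry fun (y x : ℝ³) => Env (x - y) * ‖φ x‖) :=
      ((hEnvmeas.comp (measurable_snd.sub measurable_fst)).mul
        (hφc.measurable.comp measurable_snd).norm).stronglyMeasurable
    exact h.integral_prod_right.aestronglyMeasurable
  have hTr : eLpNorm T r volume < ⊤ := by
    have h := eLpNorm_le_lintegral_mul_eLpNorm_of_dominated hEnvm (hφmem r).1 hTdom hr1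
    refine lt_of_le_of_lt h (ENNReal.mul_lt_top ?_ (hφmem r).2)
    rw [lintegral_enorm_oseenEnvelope hC.le hσ]
    exact ENNReal.ofReal_lt_top
  -- measurability of the integrand on the product
  have hFm : AEStronglyMeasurable (uncurry fun (x y : ℝ³) => ⟪oseenKernel σ (x - y) (a y) (b y), φ x⟫)
      ((volume : Measure ℝ³).prod (volume : Measure ℝ³)) := by
    have hKm : AEMeasurable (fun q : ℝ³ × ℝ³ => oseenKernel σ (q.1 - q.2) (a q.2) (b q.2))
        ((volume : Measure ℝ³).prod (volume : Measure ℝ³)) :=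
      AEMeasurable.oseenKernel_comp aemeasurable_const (measurable_fst.sub measurable_snd).aemeasurable
        (ha.1.comp_snd (μ := (volume : Measure ℝ³))).aemeasurable
        (hb.1.comp_snd (μ := (volume : Measure ℝ³))).aemeasurable
    exact (hKm.inner (hφc.measurable.comp measurable_fst).aemeasurable).aestronglyMeasurable
  refine ⟨hFm, ?_⟩
  rw [hasFiniteIntegral_iff_enorm, lintegral_prod _ hFm.enorm]
  -- pointwise domination
  have hpt : ∀ x y, ‖⟪oseenKernel σ (x - y) (a y) (b y), φ x⟫‖ₑ ≤
      (‖Env (x - y)‖ₑ * ‖φ x‖ₑ) * ‖g y‖ₑ := by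
    intro x y
    have h := hK hσ (x - y) (a y) (b y)
    rw [Real.enorm_eq_ofReal_abs, Real.enorm_eq_ofReal (hEnv0 _), ← ofReal_norm (φ x),
      Real.enorm_eq_ofReal (mul_nonneg (norm_nonneg _) (norm_nonneg _)),
      ← ENNReal.ofReal_mul (hEnv0 _), ← ENNReal.ofReal_mul (mul_nonneg (hEnv0 _) (norm_nonneg _))]
    refine ENNReal.ofReal_le_ofReal ?_
    calc |⟪oseenKernel σ (x - y) (a y) (b y), φ x⟫|
        ≤ ‖oseenKernel σ (x - y) (a y) (b y)‖ * ‖φ x‖ := abs_real_inner_le_norm _ _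
      _ ≤ (C * (σ + ‖x - y‖ ^ 2) ^ (-((d + 1) / 2)) * ‖a y‖ * ‖b y‖) * ‖φ x‖ :=
          mul_le_mul_of_nonneg_right h (norm_nonneg _)
      _ = Env (x - y) * ‖φ x‖ * g y := by rw [hEnvdef, hg]; ring
  have hGm : AEMeasurable (fun q : ℝ³ × ℝ³ => (‖Env (q.1 - q.2)‖ₑ * ‖φ q.1‖ₑ) * ‖g q.2‖ₑ)
      ((volume : Measure ℝ³).prod (volume : Measure ℝ³)) :=
    ((hEnvmeas.comp (measurable_fst.sub measurable_snd)).enorm.mul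
      (hφc.measurable.comp measurable_fst).enorm).aemeasurable.mul
      (hgm.comp_snd (μ := (volume : Measure ℝ³))).enorm
  calc ∫⁻ x, ∫⁻ y, ‖uncurry (fun x y : ℝ³ => ⟪oseenKernel σ (x - y) (a y) (b y), φ x⟫) (x, y)‖ₑ
      ≤ ∫⁻ x, ∫⁻ y, (‖Env (x - y)‖ₑ * ‖φ x‖ₑ) * ‖g y‖ₑ :=
        lintegral_mono fun x => lintegral_mono fun y => hpt x y
    _ = ∫⁻ y, ∫⁻ x, (‖Env (x - y)‖ₑ * ‖φ x‖ₑ) * ‖g y‖ₑ := lintegral_lintegral_swap hGm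
    _ = ∫⁻ y, ‖T y‖ₑ * ‖g y‖ₑ := by
        refine lintegral_congr fun y => ?_
        rw [lintegral_mul_const' _ _ enorm_ne_top, hTeq y]
    _ = eLpNorm (T • g) 1 volume := by
        rw [eLpNorm_one_eq_lintegral_enorm]
        simp_rw [Pi.smul_apply', enorm_smul]
    _ ≤ eLpNorm T r volume * eLpNorm g (p / 2) volume := eLpNorm_smul_le_mul_eLpNorm hgm hTm
    _ < ⊤ := ENNReal.mul_lt_top hTr hgmem

/-- **A slice against a solenoidal test field** (Lemarié-Rieusset 2016, Thm. 6.1,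
(6.12) ⇒ (6.11); Koch–Tataru 2001, §3 (11)): for `3 < p < ∞`, `σ > 0`, `a, b ∈ L^p` and a smooth
compactly supported divergence-free `φ`,
`∫ ⟪T_σ[a,b](x), φ(x)⟫ dx = −∫ ⟪b(y), D(e^{σΔ}φ)(y) a(y)⟫ dy`. [cite: LemarieRieusset2016, Thm. 6.1 ((6.12) ⇒ (6.11))] -/
theorem integral_inner_oseenSlice_of_isDivFree (hp₃ : 3 < p) {σ : ℝ} (hσ : 0 < σ)
    {a b : ℝ³ → ℝ³} (ha : MemLp a p volume) (hb : MemLp b p volume) {φ : ℝ³ → ℝ³}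
    (hφ : FunctionSpaces.IsTestFunctionOn (⊤ : Opens ℝ³) φ) (hdiv : VectorCalculus.IsDivFree φ) :
    ∫ x, ⟪∫ y, oseenKernel σ (x - y) (a y) (b y), φ x⟫ =
      -∫ y, ⟪b y, fderiv ℝ (UnboundedOperators.heatExtension φ σ) y (a y)⟫ := by
  have hφc : Continuous φ := hφ.contDiff.continuous
  have hφs : HasCompactSupport φ := hφ.hasCompactSupport
  have hprod := integrable_inner_oseenSlice_prod hp₃ hσ ha hb hφc hφs
  have hinner : ∀ x, ⟪∫ y, oseenKernel σ (x - y) (a y) (b y), φ x⟫ =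
      ∫ y, ⟪oseenKernel σ (x - y) (a y) (b y), φ x⟫ := by
    intro x
    have hint := integrable_oseenSlice hp₃ hσ ha hb x
    rw [real_inner_comm, ← integral_inner hint (φ x)]
    exact integral_congr_ae (Eventually.of_forall fun y => real_inner_comm _ _)
  calc ∫ x, ⟪∫ y, oseenKernel σ (x - y) (a y) (b y), φ x⟫
      = ∫ x, ∫ y, ⟪oseenKernel σ (x - y) (a y) (b y), φ x⟫ :=
        integral_congr_ae (Eventually.of_forall hinner)
    _ = ∫ y, ∫ x, ⟪oseenKernel σ (x - y) (a y) (b y), φ x⟫ := integral_integral_swap hprod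
    _ = ∫ y, -⟪b y, fderiv ℝ (UnboundedOperators.heatExtension φ σ) y (a y)⟫ :=
        integral_congr_ae (Eventually.of_forall fun y =>
          integral_inner_oseenKernel_comp_sub_of_isDivFree hσ y (a y) (b y) hφ hdiv)
    _ = -∫ y, ⟪b y, fderiv ℝ (UnboundedOperators.heatExtension φ σ) y (a y)⟫ := integral_neg _

/-- **A slice against a gradient vanishes**: for `3 < p < ∞`, `σ > 0`, `a, b ∈ L^p` and
`θ ∈ C_c^∞`, `∫ ⟪T_σ[a,b](x), ∇θ(x)⟫ dx = 0` (the kernel is divergence free,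
`integral_inner_oseenKernel_comp_sub_gradient`). [cite: KochTataruAdvMath2001, §2 (5)–(8)] -/
theorem integral_inner_oseenSlice_gradient (hp₃ : 3 < p) {σ : ℝ} (hσ : 0 < σ)
    {a b : ℝ³ → ℝ³} (ha : MemLp a p volume) (hb : MemLp b p volume) {θ : ℝ³ → ℝ}
    (hθ : FunctionSpaces.IsTestFunctionOn (⊤ : Opens ℝ³) θ) :
    ∫ x, ⟪∫ y, oseenKernel σ (x - y) (a y) (b y), gradient θ x⟫ = 0 := by
  haveI : CompleteSpace ℝ³ := FiniteDimensional.complete ℝ ℝ³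
  have hθ1 : ContDiff ℝ 1 θ := hθ.contDiff.of_le (by exact_mod_cast le_top)
  have hgc : Continuous (gradient θ) := continuous_gradient_of_contDiff hθ1
  have hgs : HasCompactSupport (gradient θ) :=
    (hθ.hasCompactSupport.fderiv (𝕜 := ℝ)).comp_left (g := (InnerProductSpace.toDual ℝ ℝ³).symm)
      (map_zero _)
  have hprod := integrable_inner_oseenSlice_prod hp₃ hσ ha hb hgc hgs
  have hinner : ∀ x, ⟪∫ y, oseenKernel σ (x - y) (a y) (b y), gradient θ x⟫ =
      ∫ y, ⟪oseenKernel σ (x - y) (a y) (b y), gradient θ x⟫ := by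
    intro x
    have hint := integrable_oseenSlice hp₃ hσ ha hb x
    rw [real_inner_comm, ← integral_inner hint (gradient θ x)]
    exact integral_congr_ae (Eventually.of_forall fun y => real_inner_comm _ _)
  calc ∫ x, ⟪∫ y, oseenKernel σ (x - y) (a y) (b y), gradient θ x⟫
      = ∫ x, ∫ y, ⟪oseenKernel σ (x - y) (a y) (b y), gradient θ x⟫ :=
        integral_congr_ae (Eventually.of_forall hinner)
    _ = ∫ y, ∫ x, ⟪oseenKernel σ (x - y) (a y) (b y), gradient θ x⟫ := integral_integral_swap hprod
    _ = ∫ y, (0 : ℝ) := integral_congr_ae (Eventually.of_forall fun y =>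
          integral_inner_oseenKernel_comp_sub_gradient hσ y (a y) (b y) hθ)
    _ = 0 := by simp

end SlicePairing

/-! ### The tested form of `B(u, v)(t)` and its weak divergence-freeness -/

section Tested

variable {p : ℝ≥0∞} {u v : ℝ → ℝ³ → ℝ³} {t Ku Kv : ℝ}

/-- From a weighted `L^p` bound to the `L^p` class of a slice. [folklore] -/
theorem memLp_slice_of_bound (hum : Measurable (uncurry u)) {τ K e : ℝ}
    (h : eLpNorm (u τ) p volume ≤ ENNReal.ofReal (K * τ ^ e)) : MemLp (u τ) p volume :=
  ⟨(measurable_slice hum τ).aestronglyMeasurable, lt_of_le_of_lt h ENNReal.ofReal_lt_top⟩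

set_option maxHeartbeats 800000 in
/-- **`B(u, v)(t)` against a continuous compactly supported field is the time integral of the
tested slices** (Fubini over `ℝ³ × (0, t)`, justified by the Tonelli majorant
`exists_lintegral_slices_pairing_le` with `ψ = |φ| ∈ L^{p'}`, the time integral converging
absolutely at a.e. `x`, `ae_integrableOn_slices`): for `3 < p < ∞`, Kato-weighted `u, v` and
`t > 0`, `∫ ⟪B(u,v)(t,x), φ(x)⟫ dx = ∫_{(0,t)} ∫ ⟪T_{t−τ}[u(τ), v(τ)](x), φ(x)⟫ dx dτ`.
[cite: KochTataruAdvMath2001, §3 (11)–(12)] -/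
theorem integral_inner_kochTataruBilinear_eq_setIntegral (hp₃ : 3 < p) (hp : p < ∞)
    (hum : Measurable (uncurry u)) (hvm : Measurable (uncurry v)) (hKu : 0 ≤ Ku) (hKv : 0 ≤ Kv)
    (ht : 0 < t)
    (hu : ∀ τ ∈ Ioo 0 t, eLpNorm (u τ) p volume ≤
      ENNReal.ofReal (Ku * τ ^ (-((1 - 3 / p.toReal) / 2))))
    (hv : ∀ τ ∈ Ioo 0 t, eLpNorm (v τ) p volume ≤
      ENNReal.ofReal (Kv * τ ^ (-((1 - 3 / p.toReal) / 2))))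
    {φ : ℝ³ → ℝ³} (hφc : Continuous φ) (hφs : HasCompactSupport φ) :
    ∫ x, ⟪kochTataruBilinear u v t x, φ x⟫ =
      ∫ τ in Ioo 0 t, ∫ x, ⟪∫ y, oseenKernel (t - τ) (x - y) (u τ y) (v τ y), φ x⟫ := by
  obtain ⟨c, hc, hmaj⟩ := exists_lintegral_slices_pairing_le (p := p) hp₃ hp
  have hp1 : 1 < p := lt_trans (by norm_num) hp₃
  set Sl : ℝ → ℝ³ → ℝ³ := fun τ x => ∫ y, oseenKernel (t - τ) (x - y) (u τ y) (v τ y) with hSl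
  have hSm : StronglyMeasurable (uncurry Sl) := by
    have h := stronglyMeasurable_oseenIntegrand hum hvm 1 t
    simp only [one_mul] at h
    exact h
  have h1 : Measurable fun q : ℝ³ × ℝ => Sl q.2 q.1 := by
    have e : (fun q : ℝ³ × ℝ => Sl q.2 q.1) = uncurry Sl ∘ Prod.swap := by
      funext q; rfl
    rw [e]
    exact hSm.measurable.comp measurable_swap
  -- `B(u,v)(t,x)` is the time integral of the slices
  have hB : ∀ x, kochTataruBilinear u v t x = ∫ τ in Ioo 0 t, Sl τ x := fun x => rfl
  -- Step 1: the inner product through the time integral, at a.e. `x`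
  have hae := ae_integrableOn_slices (p := p) hp₃ hp hum hvm hKu hKv ht hu hv
  have hstep1 : (fun x => ⟪kochTataruBilinear u v t x, φ x⟫) =ᵐ[volume]
      fun x => ∫ τ in Ioo 0 t, ⟪Sl τ x, φ x⟫ := by
    filter_upwards [hae] with x hx
    rw [hB x, real_inner_comm, ← integral_inner hx (φ x)]
    exact integral_congr_ae (Eventually.of_forall fun τ => real_inner_comm _ _)
  -- Step 2: Fubini over `ℝ³ × (0, t)`
  have hφψ : AEStronglyMeasurable (fun x => ‖φ x‖) volume := hφc.norm.aestronglyMeasurable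
  have hφmem : MemLp (fun x => ‖φ x‖) (1 - p⁻¹)⁻¹ volume :=
    (hφc.norm).memLp_of_hasCompactSupport hφs.norm
  have hFm : AEStronglyMeasurable (uncurry fun (x : ℝ³) (τ : ℝ) => ⟪Sl τ x, φ x⟫)
      ((volume : Measure ℝ³).prod (volume.restrict (Ioo 0 t))) :=
    (h1.inner (hφc.measurable.comp measurable_fst)).aestronglyMeasurable
  have hprod : Integrable (uncurry fun (x : ℝ³) (τ : ℝ) => ⟪Sl τ x, φ x⟫)
      ((volume : Measure ℝ³).prod (volume.restrict (Ioo 0 t))) := by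
    refine ⟨hFm, ?_⟩
    rw [hasFiniteIntegral_iff_enorm, lintegral_prod _ hFm.enorm]
    have hG : AEMeasurable (uncurry fun (x : ℝ³) (τ : ℝ) => ‖Sl τ x‖ₑ * ‖(fun x => ‖φ x‖) x‖ₑ)
        ((volume : Measure ℝ³).prod (volume.restrict (Ioo 0 t))) :=
      (h1.enorm.mul (hφc.measurable.comp measurable_fst).norm.enorm).aemeasurable
    calc ∫⁻ x, ∫⁻ τ in Ioo 0 t, ‖uncurry (fun (x : ℝ³) (τ : ℝ) => ⟪Sl τ x, φ x⟫) (x, τ)‖ₑ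
        ≤ ∫⁻ x, ∫⁻ τ in Ioo 0 t, ‖Sl τ x‖ₑ * ‖(fun x => ‖φ x‖) x‖ₑ := by
          refine lintegral_mono fun x => lintegral_mono fun τ => ?_
          simp only [uncurry_apply_pair, enorm_norm]
          rw [Real.enorm_eq_ofReal_abs, ← ofReal_norm, ← ofReal_norm,
            ← ENNReal.ofReal_mul (norm_nonneg _)]
          exact ENNReal.ofReal_le_ofReal (abs_real_inner_le_norm _ _)
      _ = ∫⁻ τ in Ioo 0 t, ∫⁻ x, ‖Sl τ x‖ₑ * ‖(fun x => ‖φ x‖) x‖ₑ := lintegral_lintegral_swap hG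
      _ ≤ ENNReal.ofReal (c * Ku * Kv * t ^ (-((1 - 3 / p.toReal) / 2))) *
            eLpNorm (fun x => ‖φ x‖) (1 - p⁻¹)⁻¹ volume := hmaj hum hvm hKu hKv ht hu hv hφψ
      _ < ⊤ := ENNReal.mul_lt_top ENNReal.ofReal_lt_top hφmem.2
  calc ∫ x, ⟪kochTataruBilinear u v t x, φ x⟫ = ∫ x, ∫ τ in Ioo 0 t, ⟪Sl τ x, φ x⟫ :=
        integral_congr_ae hstep1
    _ = ∫ τ in Ioo 0 t, ∫ x, ⟪Sl τ x, φ x⟫ := integral_integral_swap hprod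

/-- **`B(u, v)(t)` tested against a solenoidal field**: for `3 < p < ∞`, Kato-weighted `u, v`,
`t > 0` and `φ ∈ C_c^∞` divergence free,
`∫ ⟪B(u,v)(t), φ⟫ = -∫_{(0,t)} ∫ ⟪v(τ,y), D(e^{(t-τ)Δ}φ)(y) u(τ,y)⟫ dy dτ`
(Lemarié-Rieusset 2016, Thm. 6.1, (6.12) ⇒ (6.11)). [cite: LemarieRieusset2016, Thm. 6.1 ((6.12) ⇒ (6.11))] -/
theorem integral_inner_kochTataruBilinear_of_isDivFree (hp₃ : 3 < p) (hp : p < ∞)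
    (hum : Measurable (uncurry u)) (hvm : Measurable (uncurry v)) (hKu : 0 ≤ Ku) (hKv : 0 ≤ Kv)
    (ht : 0 < t)
    (hu : ∀ τ ∈ Ioo 0 t, eLpNorm (u τ) p volume ≤
      ENNReal.ofReal (Ku * τ ^ (-((1 - 3 / p.toReal) / 2))))
    (hv : ∀ τ ∈ Ioo 0 t, eLpNorm (v τ) p volume ≤
      ENNReal.ofReal (Kv * τ ^ (-((1 - 3 / p.toReal) / 2))))
    {φ : ℝ³ → ℝ³} (hφ : FunctionSpaces.IsTestFunctionOn (⊤ : Opens ℝ³) φ)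
    (hdiv : VectorCalculus.IsDivFree φ) :
    ∫ x, ⟪kochTataruBilinear u v t x, φ x⟫ =
      -∫ τ in Ioo 0 t, ∫ y, ⟪v τ y,
        fderiv ℝ (UnboundedOperators.heatExtension φ (t - τ)) y (u τ y)⟫ := by
  rw [integral_inner_kochTataruBilinear_eq_setIntegral hp₃ hp hum hvm hKu hKv ht hu hv
    hφ.contDiff.continuous hφ.hasCompactSupport, ← integral_neg]
  refine setIntegral_congr_fun measurableSet_Ioo fun τ hτ => ?_
  exact integral_inner_oseenSlice_of_isDivFree hp₃ (sub_pos.2 hτ.2)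
    (memLp_slice_of_bound hum (hu τ hτ)) (memLp_slice_of_bound hvm (hv τ hτ)) hφ hdiv

/-- **`B(u, u)(t)` tested in the duality form of the tree** (the nonlinear term of
`IsMildNSSolutionFrom 1 0 u₀ u t`): for `t > 0` and a divergence-free test field `φ`,
`∫ ⟪B(u,u)(t), φ⟫ = -∫₀ᵗ ∫ ⟪u(τ), (u(τ)·∇) e^{(t-τ)Δ}φ⟫ dτ`. [cite: LemarieRieusset2016, Thm. 6.1 ((6.12) ⇒ (6.11))] -/
theorem integral_inner_kochTataruBilinear_eq_neg_intervalIntegral (hp₃ : 3 < p) (hp : p < ∞)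
    (hum : Measurable (uncurry u)) (hKu : 0 ≤ Ku) (ht : 0 < t)
    (hu : ∀ τ ∈ Ioo 0 t, eLpNorm (u τ) p volume ≤
      ENNReal.ofReal (Ku * τ ^ (-((1 - 3 / p.toReal) / 2))))
    {φ : ℝ³ → ℝ³} (hφ : FunctionSpaces.IsTestFunctionOn (⊤ : Opens ℝ³) φ)
    (hdiv : VectorCalculus.IsDivFree φ) :
    ∫ x, ⟪kochTataruBilinear u u t x, φ x⟫ =
      -∫ τ in 0..t, ∫ y, ⟪u τ y, convect (u τ) (heatTest 1 φ (t - τ)) y⟫ := by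
  rw [integral_inner_kochTataruBilinear_of_isDivFree hp₃ hp hum hum hKu hKu ht hu hu hφ hdiv,
    intervalIntegral.integral_of_le ht.le, integral_Ioc_eq_integral_Ioo]
  congr 1
  refine setIntegral_congr_fun measurableSet_Ioo fun τ hτ => ?_
  have hpos : 0 < t - τ := sub_pos.2 hτ.2
  simp only [convect_apply, heatTest_of_pos one_pos hpos, one_mul]

/-- **`B(u, v)(t)` is weakly divergence free** (for `3 < p < ∞`, Kato-weighted `u, v`, `t > 0`;
the kernel of `V∇Π` is divergence free in `z`, Koch–Tataru 2001, §2–§3). [cite: KochTataruAdvMath2001, §2 (5)–(8) and §3 (11)] -/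
theorem isWeaklyDivFree_kochTataruBilinear (hp₃ : 3 < p) (hp : p < ∞)
    (hum : Measurable (uncurry u)) (hvm : Measurable (uncurry v)) (hKu : 0 ≤ Ku) (hKv : 0 ≤ Kv)
    (ht : 0 < t)
    (hu : ∀ τ ∈ Ioo 0 t, eLpNorm (u τ) p volume ≤
      ENNReal.ofReal (Ku * τ ^ (-((1 - 3 / p.toReal) / 2))))
    (hv : ∀ τ ∈ Ioo 0 t, eLpNorm (v τ) p volume ≤
      ENNReal.ofReal (Kv * τ ^ (-((1 - 3 / p.toReal) / 2)))) :
    IsWeaklyDivFree (kochTataruBilinear u v t) := by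
  haveI : CompleteSpace ℝ³ := FiniteDimensional.complete ℝ ℝ³
  intro θ hθ
  have hθ1 : ContDiff ℝ 1 θ := hθ.contDiff.of_le (by exact_mod_cast le_top)
  have hgc : Continuous (gradient θ) := continuous_gradient_of_contDiff hθ1
  have hgs : HasCompactSupport (gradient θ) :=
    (hθ.hasCompactSupport.fderiv (𝕜 := ℝ)).comp_left (g := (InnerProductSpace.toDual ℝ ℝ³).symm)
      (map_zero _)
  rw [integral_inner_kochTataruBilinear_eq_setIntegral hp₃ hp hum hvm hKu hKv ht hu hv hgc hgs,
    setIntegral_congr_fun measurableSet_Ioo (g := fun _ => (0 : ℝ)) (fun τ hτ => ?_)]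
  · simp
  · exact integral_inner_oseenSlice_gradient hp₃ (sub_pos.2 hτ.2)
      (memLp_slice_of_bound hum (hu τ hτ)) (memLp_slice_of_bound hvm (hv τ hτ)) hθ

end Tested

end LpOseen

end Literature.Analysis.FluidPDE

end
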